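import Summits.HodgeConjecture.HodgeConjecture.Theorems.Ring2AbelianAllAndreOddCellKTopLineSwap
import Summits.HodgeConjecture.HodgeConjecture.Theorems.Ring2AbelianAllAndreOddCellMembers
import HarnessLib

/-!
# Ring 2 · AbelianAll — ANDRÉ AXIS, PART U — U-f: THE PRODUCT PENCIL `A_t × 𝒳 ⟶ S` — charts, twisted-product `K`-action, transport of Weil type / discriminant / hyperbolicity from ONE member, g2's residual from pencil `K`-data, the `+`-part `U₊` (Sketch §F2, §F4–§F7)

HONEST FRAMING (page 1, verbatim): **research route, not a corollary; conditional on HC_CM plus one named minimal statement.** Cell line: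
research route conditional on HC_CM; not a corollary; Q11.4-sentence-2 already refuted in dim ≥ 3. Nothing in this file proves a case of
the Hodge conjecture or `B(X)` for a named `X`; `HC_CM`, `HC_AV` and the global nodes are ABSENT; every bracket / residual / crux below is a
HYPOTHESIS wherever used (`@[conjecture] def`), never asserted. Item `Theses.RankFourFaces.CMToAbelian` (stmt-16267) stays OPEN; N104 untouched.

PROVENANCE. Seat `pub-hodge-ring2-ab-andre-2`, gen 52 (PART U: the ODD CELL at relative dimension three on the André axis). The
mathematics of this part was PLANNED AND KERNEL-CHECKED AT MEMO LEVEL by the (lapsed) ideation seat vhodge-p6 (gens 0–6, 2026-08-25) in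
`run/shared/lean/pub/vhodge/memos/ROUTE-P6-g4-Sketch.lean` (sha16 a5719f36; 2548 lines; farm rc 0, 0 sorries, 0 errors; re-checked by this seat
2026-08-26T02:34Z, 60 s) on top of this seat's parts XXXV–T; it never entered the tree (the planner seat files nothing; director-hodge ruling
2026-08-25T21:26:55Z «(B) LAPSE with (A) banked»: landing the Sketch's statement vocabulary + kernel chain as Theorems files is cost item (A)(1)
of the banked ladder rung H1d′ «Lefschetz B for compact abelian-threefold pencils, odd cell»). This file is that landing for the sections named
in its title: declarations VERBATIM from the Sketch (namespace moved from `…VHodgeP6` to `…Ring2.AbelianAll.OddCell`, the memo-level `abbrev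
FirstTarget` replaced by the constant `LefschetzBOddPencilsRelDimThree`, lint repairs, sections re-cut to the tree's 400-line files), credited
decl by decl to the memo; the seat's own additions are marked «(ab-andre-2, gen 52)».

CONTENT (Sketch lines 694–755, 834–1018, 1020–1067; theorems only): charts `A_s × A_t ≅ (A_t × 𝒳)_s` of the product pencil and its global
endomorphism `(−φ_t) × Φ` (`exists_productPencilCharts`); **every twisted product `(A_s × A_t, φ_s × (−φ_t))` of a Weil-type pencil with a
`K`-action is of Weil type `(q+1, q+1)`, split discriminant, and HYPERBOLIC as soon as the twisted square at `t` is** (`twistedProduct_members_of_hyperbolicMember`,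
`twistedProduct_members_weilType_hyperbolic`, on the tree's `isHyperbolicWeilType_member_of_hyperbolicMember`); `twistedProductWeilDataAt_of_kAction`
(four of the seven conjuncts of g2's residual discharged). EDGE LABELS: K (fact-free).
-/

noncomputable section

namespace Summit.HodgeConjecture.HodgeConjecture.Ring2.AbelianAll.OddCell

set_option linter.dupNamespace false

open CategoryTheory CategoryTheory.Limits AlgebraicGeometry MonoidalCategory CartesianMonoidalCategory
open Literature.AlgebraicGeometry Literature.AlgebraicGeometry.Motives
open Literature.AlgebraicGeometry.HodgeTheory
open Literature.AlgebraicTopology.SingularHomology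
open Literature.AlgebraicGeometry.VanGeemen1994
open Literature.AlgebraicGeometry.Andre1996 (compactPencil_dim_eq_of_iso)
open Summit.HodgeConjecture.HodgeConjecture
open Summit.HodgeConjecture.HodgeConjecture.Theses
open Summit.HodgeConjecture.HodgeConjecture.Ring2.AbelianAll
open Summit.HodgeConjecture.HodgeConjecture.Theorems (deg_fiberGysin_aux exists_fibreClassInverse_deg_of_lefschetzBCompactPencils)
open scoped MonObj

variable {𝒳 S : SchemeOver ℂ} {f : 𝒳 ⟶ S}

/-- DISPLAY bracket: the TWISTED PRODUCT endomorphism `φ_s × (−φ_t)` of `A_s × A_t`. [cite: vanGeemen1994HodgeAV, 4.9] -/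
local notation3 (prettyPrint := false) "ΨK[" A ", " φ ", " s ", " t "]" =>
  AbelianVariety.prodLift (AbelianVariety.fst (A s) (A t) ≫ φ s) (AbelianVariety.snd (A s) (A t) ≫ (-(φ t)))

/-! ## §F2  Charts and `K`-action of the product pencil `A_t × 𝒳 ⟶ S` -/

/-- The two projections of the twisted product endomorphism on underlying schemes. [folklore] -/
theorem twistedProd_hom_fst (A : ComplexPoints S → AbelianVariety ℂ) (φ : ∀ s, A s ⟶ A s) (s t : ComplexPoints S) :
    (ΨK[A, φ, s, t]).hom.hom.hom ≫ (AbelianVariety.fst (A s) (A t)).hom.hom.hom =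
      (AbelianVariety.fst (A s) (A t)).hom.hom.hom ≫ (φ s).hom.hom.hom := by
  change (ΨK[A, φ, s, t] ≫ AbelianVariety.fst (A s) (A t)).hom.hom.hom = (AbelianVariety.fst (A s) (A t) ≫ φ s).hom.hom.hom
  rw [AbelianVariety.prodLift_fst]

/-- Second projection of the twisted product endomorphism on underlying schemes. [folklore] -/
theorem twistedProd_hom_snd (A : ComplexPoints S → AbelianVariety ℂ) (φ : ∀ s, A s ⟶ A s) (s t : ComplexPoints S) :
    (ΨK[A, φ, s, t]).hom.hom.hom ≫ (AbelianVariety.snd (A s) (A t)).hom.hom.hom =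
      (AbelianVariety.snd (A s) (A t)).hom.hom.hom ≫ (-(φ t)).hom.hom.hom := by
  change (ΨK[A, φ, s, t] ≫ AbelianVariety.snd (A s) (A t)).hom.hom.hom = (AbelianVariety.snd (A s) (A t) ≫ (-(φ t))).hom.hom.hom
  rw [AbelianVariety.prodLift_snd]

/-- **CHARTS OF THE PRODUCT PENCIL `A_t × 𝒳 ⟶ S` BY THE TWISTED PRODUCTS `(A_s × A_t, φ_s × (−φ_t))`.** For a pencil `f` with an
endomorphism `Φ` and `K`-compatible charts `(A_s, e_s, φ_s)`, the product pencil `pr₂ ≫ f : A_t × 𝒳 ⟶ S` (tree: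
`isCompactAbelianPencil_snd_comp`) is charted at `s` by `A_s × A_t` through the swap and `A_t × X_s ≅ (A_t × 𝒳)_s`, and the global
endomorphism `(−φ_t) × Φ` of `A_t × 𝒳` restricts on these charts to the twisted products `φ_s × (−φ_t)`. [folklore]
[cite: vanGeemen1994HodgeAV, 4.9] -/
theorem exists_productPencilCharts (Φ : 𝒳 ⟶ 𝒳)
    (A : ComplexPoints S → AbelianVariety ℂ) (e : ∀ s, (A s).X ≅ fiberOver f s) (φ : ∀ s, A s ⟶ A s)
    (hK : ∀ s, ∃ Φs : fiberOver f s ⟶ fiberOver f s, Φs ≫ fiberι f s = fiberι f s ≫ Φ ∧ (e s).hom ≫ Φs = (φ s).hom.hom.hom ≫ (e s).hom)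
    (t : ComplexPoints S) :
    ∃ e' : ∀ s, ((A s).prod (A t)).X ≅ fiberOver (snd (A t).X 𝒳 ≫ f) s,
      (∀ s, (e' s).hom ≫ fiberι (snd (A t).X 𝒳 ≫ f) s =
        (prodSwap (A s) (A t)).hom ≫ (A t).X ◁ ((e s).hom ≫ fiberι f s)) ∧
      ∀ s, ∃ Φs : fiberOver (snd (A t).X 𝒳 ≫ f) s ⟶ fiberOver (snd (A t).X 𝒳 ≫ f) s,
        Φs ≫ fiberι (snd (A t).X 𝒳 ≫ f) s = fiberι (snd (A t).X 𝒳 ≫ f) s ≫ ((-(φ t)).hom.hom.hom ⊗ₘ Φ) ∧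
        (e' s).hom ≫ Φs = (ΨK[A, φ, s, t]).hom.hom.hom ≫ (e' s).hom := by
  classical
  choose ep hep using fun s ↦ exists_fiberOver_snd_comp_iso f (A t).X s
  refine ⟨fun s ↦ prodSwap (A s) (A t) ≪≫ whiskerLeftIso (A t).X (e s) ≪≫ ep s, fun s ↦ ?_, fun s ↦ ?_⟩
  · simp only [Iso.trans_hom, whiskerLeftIso_hom, Category.assoc, hep s, ← MonoidalCategory.whiskerLeft_comp]
    try rfl
  · obtain ⟨Φs, hΦs, hes⟩ := hK s
    have hfst := twistedProd_hom_fst A φ s t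
    have hsnd := twistedProd_hom_snd A φ s t
    refine ⟨(ep s).inv ≫ ((-(φ t)).hom.hom.hom ⊗ₘ Φs) ≫ (ep s).hom, ?_, ?_⟩
    · have h1 : fiberι (snd (A t).X 𝒳 ≫ f) s = (ep s).inv ≫ (A t).X ◁ fiberι f s := by
        rw [← hep s, Iso.inv_hom_id_assoc]
      have h2 : ((-(φ t)).hom.hom.hom ⊗ₘ Φs) ≫ (A t).X ◁ fiberι f s = (A t).X ◁ fiberι f s ≫ ((-(φ t)).hom.hom.hom ⊗ₘ Φ) :=
        CartesianMonoidalCategory.hom_ext _ _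
          (by simp only [Category.assoc, whiskerLeft_fst, tensorHom_fst, whiskerLeft_fst_assoc])
          (by simp only [Category.assoc, whiskerLeft_snd, tensorHom_snd, tensorHom_snd_assoc, whiskerLeft_snd_assoc, hΦs])
      simp only [Category.assoc]
      rw [hep s, h1, Category.assoc, h2]
    · have haux : (prodSwap (A s) (A t)).hom ≫ (A t).X ◁ (e s).hom ≫ ((-(φ t)).hom.hom.hom ⊗ₘ Φs) =
          (ΨK[A, φ, s, t]).hom.hom.hom ≫ (prodSwap (A s) (A t)).hom ≫ (A t).X ◁ (e s).hom :=
        CartesianMonoidalCategory.hom_ext _ _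
          (by simp only [Category.assoc, tensorHom_fst, whiskerLeft_fst_assoc, whiskerLeft_fst, prodSwap_hom_fst,
                prodSwap_hom_fst_assoc, hsnd])
          (by simp only [Category.assoc, tensorHom_snd, whiskerLeft_snd_assoc, whiskerLeft_snd, prodSwap_hom_snd_assoc,
                hes, reassoc_of% hfst])
      simp only [Iso.trans_hom, whiskerLeftIso_hom, Category.assoc, Iso.hom_inv_id_assoc]
      exact (reassoc_of% haux) (ep s).hom

/-! ## §F4  Transport along the product pencil: every twisted product member from ONE hyperbolic member -/

/-- **EVERY TWISTED PRODUCT `(A_s × A_t, φ_s × (−φ_t))` OF A WEIL-TYPE PENCIL WITH A `K`-ACTION IS OF WEIL TYPE `(q+1, q+1)`, OF SPLIT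
DISCRIMINANT, AND HYPERBOLIC AS SOON AS THE TWISTED SQUARE AT `t` IS** (connectedness transport of the tree's
`isHyperbolicWeilType_member_of_hyperbolicMember` along the product pencil `A_t × 𝒳 ⟶ S` with its global endomorphism `(−φ_t) × Φ`,
§F2; the twisted square at `t` is of Weil type by the tree's `isWeilType_twistedSquare`). Inputs at `t` only: an algebraic-side class
`U₊` on `A_t × 𝒳` restricting to `E₊ ∖ 0` of the twisted square, and hyperbolicity of the twisted square for the restricted
`K`-symmetrised class of an ambient embedding `E'` of `A_t × 𝒳`. [cite: vanGeemen1994HodgeAV, 4.9, 4.11–4.12, 5.2 and 6.12]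
[cite: Deligne1982HodgeCycles, Thm. 4.8 with proof (Milne re-ed. pp. 35–37)] -/
theorem twistedProduct_members_of_hyperbolicMember {q dK : ℕ} (hdK : 0 < dK) (hf : IsCompactAbelianPencil f (q + 1))
    (Φ : 𝒳 ⟶ 𝒳) (hΦ : Φ ≫ f = f)
    (A : ComplexPoints S → AbelianVariety ℂ) (e : ∀ s, (A s).X ≅ fiberOver f s) (φ : ∀ s, A s ⟶ A s)
    (hφ : ∀ s, φ s ≫ φ s = -(dK • 𝟙 (A s)))
    (hK : ∀ s, ∃ Φs : fiberOver f s ⟶ fiberOver f s, Φs ≫ fiberι f s = fiberι f s ≫ Φ ∧ (e s).hom ≫ Φs = (φ s).hom.hom.hom ≫ (e s).hom)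
    (t : ComplexPoints S)
    (E' : ProjectiveEmbedding ((A t).X ⊗ 𝒳)) {a' : complexBetti (projectiveSpace E'.n ℂ) 2} (ha' : IsRationalClass a') (ha0' : a' ≠ 0)
    (Up : complexBetti ((A t).X ⊗ 𝒳) (2 * (q + 1)))
    (hUpt : complexBetti.map ((prodSwap (A t) (A t)).hom ≫ (A t).X ◁ ((e t).hom ≫ fiberι f t)) (2 * (q + 1)) Up ∈
      weilClassesPlus ((A t).prod (A t)) ΨK[A, φ, t, t] (q + 1) dK)
    (hUp0 : complexBetti.map ((A t).X ◁ fiberι f t) (2 * (q + 1)) Up ≠ 0)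
    (hhyp : IsHyperbolicWeilType ((A t).prod (A t)) ΨK[A, φ, t, t] (q + 1)
      (complexBetti.map ((prodSwap (A t) (A t)).hom ≫ (A t).X ◁ ((e t).hom ≫ fiberι f t)) 2
        ((dK : ℂ) • complexBetti.map E'.ι 2 a' + complexBetti.map ((-(φ t)).hom.hom.hom ⊗ₘ Φ) 2 (complexBetti.map E'.ι 2 a'))))
    (s : ComplexPoints S) :
    IsWeilType ((A s).prod (A t)) ΨK[A, φ, s, t] (q + 1) dK ∧
      HasWeilDiscriminantNondeg ((A s).prod (A t)) ΨK[A, φ, s, t] (q + 1) dK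
        (complexBetti.map ((prodSwap (A s) (A t)).hom ≫ (A t).X ◁ ((e s).hom ≫ fiberι f s)) 2
          ((dK : ℂ) • complexBetti.map E'.ι 2 a' + complexBetti.map ((-(φ t)).hom.hom.hom ⊗ₘ Φ) 2 (complexBetti.map E'.ι 2 a')))
        (QuotientGroup.mk ((-1 : ℚˣ) ^ (q + 1))) ∧
      IsHyperbolicWeilType ((A s).prod (A t)) ΨK[A, φ, s, t] (q + 1)
        (complexBetti.map ((prodSwap (A s) (A t)).hom ≫ (A t).X ◁ ((e s).hom ≫ fiberι f s)) 2
          ((dK : ℂ) • complexBetti.map E'.ι 2 a' + complexBetti.map ((-(φ t)).hom.hom.hom ⊗ₘ Φ) 2 (complexBetti.map E'.ι 2 a'))) := by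
  classical
  obtain ⟨e', hcomp, hK'⟩ := exists_productPencilCharts Φ A e φ hK t
  have hf' : IsCompactAbelianPencil (snd (A t).X 𝒳 ≫ f) ((A t).dim + (q + 1)) := isCompactAbelianPencil_snd_comp hf (A t)
  have hΦ' : ((-(φ t)).hom.hom.hom ⊗ₘ Φ) ≫ (snd (A t).X 𝒳 ≫ f) = snd (A t).X 𝒳 ≫ f := by
    rw [← Category.assoc, tensorHom_snd, Category.assoc, hΦ]
  have hφ' : ∀ s, ΨK[A, φ, s, t] ≫ ΨK[A, φ, s, t] = -(dK • 𝟙 ((A s).prod (A t))) := fun s ↦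
    prod_comp_self_eq_neg_nsmul (hφ s) (by rw [Preadditive.neg_comp_neg]; exact hφ t)
      (AbelianVariety.prodLift_fst _ _) (AbelianVariety.prodLift_snd _ _)
  have hclass : ∀ (s : ComplexPoints S) (k : ℕ) (x : complexBetti ((A t).X ⊗ 𝒳) k),
      complexBetti.map (e' s).hom k (complexBetti.map (fiberι (snd (A t).X 𝒳 ≫ f) s) k x) =
        complexBetti.map ((prodSwap (A s) (A t)).hom ≫ (A t).X ◁ ((e s).hom ≫ fiberι f s)) k x := by
    intro s k x
    rw [← complexBetti.map_comp_apply', hcomp s]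
    try rfl
  have hWt : IsWeilType ((A t).prod (A t)) ΨK[A, φ, t, t] (q + 1) dK :=
    isWeilType_twistedSquare (Nat.succ_pos q) (compactPencil_dim_eq_of_iso hf (e t)) hdK (hφ t)
  have hUp0' : complexBetti.map (fiberι (snd (A t).X 𝒳 ≫ f) t) (2 * (q + 1)) Up ≠ 0 := fun h0 ↦
    hUp0 ((map_fiberι_snd_comp_eq_zero_iff_whiskerLeft f (A t).X t Up).1 h0)
  have hUpt' : complexBetti.map (e' t).hom (2 * (q + 1)) (complexBetti.map (fiberι (snd (A t).X 𝒳 ≫ f) t) (2 * (q + 1)) Up) ∈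
      weilClassesPlus ((A t).prod (A t)) ΨK[A, φ, t, t] (q + 1) dK := by
    rw [hclass]; exact hUpt
  have hhyp' : IsHyperbolicWeilType ((A t).prod (A t)) ΨK[A, φ, t, t] (q + 1)
      (complexBetti.map (e' t).hom 2 (complexBetti.map (fiberι (snd (A t).X 𝒳 ≫ f) t) 2
        ((dK : ℂ) • complexBetti.map E'.ι 2 a' + complexBetti.map ((-(φ t)).hom.hom.hom ⊗ₘ Φ) 2 (complexBetti.map E'.ι 2 a')))) := by
    rw [hclass]; exact hhyp
  obtain ⟨hW, hδ, hh⟩ := isHyperbolicWeilType_member_of_hyperbolicMember hf' _ hΦ' (fun s ↦ (A s).prod (A t)) e'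
    (fun s ↦ ΨK[A, φ, s, t]) hφ' hK' E' ha' ha0' Up hUpt' hUp0' hWt hhyp' s
  exact ⟨hW, by rw [hclass] at hδ; exact hδ, by rw [hclass] at hh; exact hh⟩

/-! ## §F5  … with the Segre embedding of the member embedding: hyperbolicity DISCHARGED -/

/-- **EVERY TWISTED PRODUCT OF A WEIL-TYPE PENCIL WITH A `K`-ACTION IS OF WEIL TYPE, OF SPLIT DISCRIMINANT AND HYPERBOLIC** —
no hyperbolicity hypothesis: embed `A_t × 𝒳` by the Segre embedding `E'` of the MEMBER embedding `e_t ≫ ι_t ≫ E` of `A_t` and `E`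
(tree: `exists_projectiveEmbedding_tensor`, for a Segre-additive family `g` of ambient classes, `exists_segreHyperplaneClasses`); its
`K`-symmetrised class restricts at `t` to `pr₁^*h_K + pr₂^*h_K`, `h_K = d_K·h + φ_t^*h`, `h = (e_t ≫ ι_t ≫ E)^*g` — the weight-one
polarized twisted square, whose `det H` is the split class by §F3 (Landherr ⟹ hyperbolic, tree: `isHyperbolicWeilType_member_of_member`).
Remaining input at `t`: the class `U₊`. [cite: vanGeemen1994HodgeAV, 4.9, 4.11–4.12, 4.14, 5.2–5.3 and 6.12]
[cite: Hartshorne1977, II Ex. 5.11 and Ex. 5.12] [cite: Deligne1982HodgeCycles, Thm. 4.8 with proof (Milne re-ed. pp. 35–37)] -/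
theorem twistedProduct_members_weilType_hyperbolic {q dK : ℕ} (hdK : 0 < dK) (hq : 1 ≤ q) (hf : IsCompactAbelianPencil f (q + 1))
    (Φ : 𝒳 ⟶ 𝒳) (hΦ : Φ ≫ f = f)
    (A : ComplexPoints S → AbelianVariety ℂ) (e : ∀ s, (A s).X ≅ fiberOver f s) (φ : ∀ s, A s ⟶ A s)
    (hφ : ∀ s, φ s ≫ φ s = -(dK • 𝟙 (A s)))
    (hK : ∀ s, ∃ Φs : fiberOver f s ⟶ fiberOver f s, Φs ≫ fiberι f s = fiberι f s ≫ Φ ∧ (e s).hom ≫ Φs = (φ s).hom.hom.hom ≫ (e s).hom)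
    (t : ComplexPoints S)
    (g : (N : ℕ) → complexBetti (projectiveSpace N ℂ) 2) (hg : ∀ N, IsRationalClass (g N)) (hg0 : ∀ N, 1 ≤ N → g N ≠ 0)
    (hgσ : ∀ n m : ℕ, complexBetti.map (segreEmbedding n m ℂ) 2 (g (n * m + n + m)) =
      complexBetti.map (fst (projectiveSpace n ℂ) (projectiveSpace m ℂ)) 2 (g n) +
        complexBetti.map (snd (projectiveSpace n ℂ) (projectiveSpace m ℂ)) 2 (g m))
    (E : ProjectiveEmbedding 𝒳) (hEn : 1 ≤ E.n)
    (Up : complexBetti ((A t).X ⊗ 𝒳) (2 * (q + 1)))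
    (hUpt : complexBetti.map ((prodSwap (A t) (A t)).hom ≫ (A t).X ◁ ((e t).hom ≫ fiberι f t)) (2 * (q + 1)) Up ∈
      weilClassesPlus ((A t).prod (A t)) ΨK[A, φ, t, t] (q + 1) dK)
    (hUp0 : complexBetti.map ((A t).X ◁ fiberι f t) (2 * (q + 1)) Up ≠ 0) :
    ∃ E' : ProjectiveEmbedding ((A t).X ⊗ 𝒳), E.n ≤ E'.n ∧
      complexBetti.map E'.ι 2 (g E'.n) =
        complexBetti.map (fst (A t).X 𝒳) 2 (complexBetti.map ((e t).hom ≫ fiberι f t ≫ E.ι) 2 (g E.n)) +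
          complexBetti.map (snd (A t).X 𝒳) 2 (complexBetti.map E.ι 2 (g E.n)) ∧
      ∀ s, IsWeilType ((A s).prod (A t)) ΨK[A, φ, s, t] (q + 1) dK ∧
        HasWeilDiscriminantNondeg ((A s).prod (A t)) ΨK[A, φ, s, t] (q + 1) dK
          (complexBetti.map ((prodSwap (A s) (A t)).hom ≫ (A t).X ◁ ((e s).hom ≫ fiberι f s)) 2
            ((dK : ℂ) • complexBetti.map E'.ι 2 (g E'.n) +
              complexBetti.map ((-(φ t)).hom.hom.hom ⊗ₘ Φ) 2 (complexBetti.map E'.ι 2 (g E'.n))))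
          (QuotientGroup.mk ((-1 : ℚˣ) ^ (q + 1))) ∧
        IsHyperbolicWeilType ((A s).prod (A t)) ΨK[A, φ, s, t] (q + 1)
          (complexBetti.map ((prodSwap (A s) (A t)).hom ≫ (A t).X ◁ ((e s).hom ≫ fiberι f s)) 2
            ((dK : ℂ) • complexBetti.map E'.ι 2 (g E'.n) +
              complexBetti.map ((-(φ t)).hom.hom.hom ⊗ₘ Φ) 2 (complexBetti.map E'.ι 2 (g E'.n)))) ∧
        ∃ (es : ProjectiveEmbedding ((A s).prod (A t)).X) (aS : complexBetti (projectiveSpace es.n ℂ) 2),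
          IsRationalClass aS ∧ aS ≠ 0 ∧
          IsHyperbolicWeilType ((A s).prod (A t)) ΨK[A, φ, s, t] (q + 1)
            ((dK : ℂ) • complexBetti.map es.ι 2 aS + complexBetti.map (ΨK[A, φ, s, t]).hom.hom.hom 2 (complexBetti.map es.ι 2 aS)) := by
  classical
  haveI : IsProper S.hom := IsSmoothProjective.isProper_holds hf.isSmoothProjective_base
  haveI : IsClosedImmersion t.left := isClosedImmersion_left_of_algPoints t
  haveI : IsClosedImmersion (fiberι f t).left :=
    MorphismProperty.pullback_fst (P := @IsClosedImmersion) f.left t.left inferInstance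
  haveI : IsClosedImmersion ((e t).hom ≫ fiberι f t ≫ E.ι).left := by
    rw [Over.comp_left, Over.comp_left]; infer_instance
  let et : ProjectiveEmbedding (A t).X := ⟨E.n, (e t).hom ≫ fiberι f t ≫ E.ι, inferInstance⟩
  obtain ⟨E', hEn', hE'⟩ := exists_projectiveEmbedding_tensor g hgσ et E
  refine ⟨E', hEn', hE', fun s ↦ ?_⟩
  obtain ⟨e', hcomp, hK'⟩ := exists_productPencilCharts Φ A e φ hK t
  have hf' : IsCompactAbelianPencil (snd (A t).X 𝒳 ≫ f) ((A t).dim + (q + 1)) := isCompactAbelianPencil_snd_comp hf (A t)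
  have hΦ' : ((-(φ t)).hom.hom.hom ⊗ₘ Φ) ≫ (snd (A t).X 𝒳 ≫ f) = snd (A t).X 𝒳 ≫ f := by
    rw [← Category.assoc, tensorHom_snd, Category.assoc, hΦ]
  have hφ' : ∀ s, ΨK[A, φ, s, t] ≫ ΨK[A, φ, s, t] = -(dK • 𝟙 ((A s).prod (A t))) := fun s ↦
    prod_comp_self_eq_neg_nsmul (hφ s) (by rw [Preadditive.neg_comp_neg]; exact hφ t)
      (AbelianVariety.prodLift_fst _ _) (AbelianVariety.prodLift_snd _ _)
  have hclass : ∀ (s : ComplexPoints S) (k : ℕ) (x : complexBetti ((A t).X ⊗ 𝒳) k),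
      complexBetti.map (e' s).hom k (complexBetti.map (fiberι (snd (A t).X 𝒳 ≫ f) s) k x) =
        complexBetti.map ((prodSwap (A s) (A t)).hom ≫ (A t).X ◁ ((e s).hom ≫ fiberι f s)) k x := by
    intro s k x
    rw [← complexBetti.map_comp_apply', hcomp s]
    try rfl
  have hdimt : (A t).dim = q + 1 := compactPencil_dim_eq_of_iso hf (e t)
  have hWt : IsWeilType ((A t).prod (A t)) ΨK[A, φ, t, t] (q + 1) dK :=
    isWeilType_twistedSquare (Nat.succ_pos q) hdimt hdK (hφ t)
  have hUp0' : complexBetti.map (fiberι (snd (A t).X 𝒳 ≫ f) t) (2 * (q + 1)) Up ≠ 0 := fun h0 ↦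
    hUp0 ((map_fiberι_snd_comp_eq_zero_iff_whiskerLeft f (A t).X t Up).1 h0)
  have hUpt' : complexBetti.map (e' t).hom (2 * (q + 1)) (complexBetti.map (fiberι (snd (A t).X 𝒳 ≫ f) t) (2 * (q + 1)) Up) ∈
      weilClassesPlus ((A t).prod (A t)) ΨK[A, φ, t, t] (q + 1) dK := by
    rw [hclass]; exact hUpt
  -- the `K`-symmetrised class of `E'` restricted to the member `t`, read on the chart: `pr₁^*h_K + pr₂^*h_K`
  set hA : complexBetti (A t).X 2 := complexBetti.map et.ι 2 (g E.n) with hAdef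
  set hKc : complexBetti (A t).X 2 := (dK : ℂ) • hA + complexBetti.map (φ t).hom.hom.hom 2 hA with hKcdef
  obtain ⟨Φt, hΦt, het⟩ := hK' t
  have hP : complexBetti.map ((e' t).hom ≫ fiberι (snd (A t).X 𝒳 ≫ f) t) 2 (complexBetti.map E'.ι 2 (g E'.n)) =
      complexBetti.map (AbelianVariety.fst (A t) (A t)).hom.hom.hom 2 hA +
        complexBetti.map (AbelianVariety.snd (A t) (A t)).hom.hom.hom 2 hA := by
    have h1 : complexBetti.map ((A t).X ◁ ((e t).hom ≫ fiberι f t)) 2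
        (complexBetti.map (fst (A t).X 𝒳) 2 (complexBetti.map et.ι 2 (g et.n))) =
        complexBetti.map (fst (A t).X (A t).X) 2 hA := by
      rw [← complexBetti.map_comp_apply', whiskerLeft_fst]
    have h2 : complexBetti.map ((A t).X ◁ ((e t).hom ≫ fiberι f t)) 2
        (complexBetti.map (snd (A t).X 𝒳) 2 (complexBetti.map E.ι 2 (g E.n))) =
        complexBetti.map (snd (A t).X (A t).X) 2 hA := by
      rw [← complexBetti.map_comp_apply', whiskerLeft_snd, complexBetti.map_comp_apply', ← complexBetti.map_comp_apply' _ E.ι,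
        Category.assoc]
    rw [hcomp t, complexBetti.map_comp_apply' (prodSwap (A t) (A t)).hom, hE', map_add, h1, h2, map_add,
      map_prodSwap_hom_map_fst, map_prodSwap_hom_map_snd, add_comm]
  have hcommute : ((e' t).hom ≫ fiberι (snd (A t).X 𝒳 ≫ f) t) ≫ ((-(φ t)).hom.hom.hom ⊗ₘ Φ) =
      (ΨK[A, φ, t, t]).hom.hom.hom ≫ ((e' t).hom ≫ fiberι (snd (A t).X 𝒳 ≫ f) t) := by
    rw [Category.assoc, ← hΦt, ← Category.assoc, het, Category.assoc]
  have hmem : complexBetti.map (e' t).hom 2 (complexBetti.map (fiberι (snd (A t).X 𝒳 ≫ f) t) 2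
      ((dK : ℂ) • complexBetti.map E'.ι 2 (g E'.n) + complexBetti.map ((-(φ t)).hom.hom.hom ⊗ₘ Φ) 2 (complexBetti.map E'.ι 2 (g E'.n)))) =
      complexBetti.map (AbelianVariety.fst (A t) (A t)).hom.hom.hom 2 hKc +
        complexBetti.map (AbelianVariety.snd (A t) (A t)).hom.hom.hom 2 hKc := by
    rw [← complexBetti.map_comp_apply', map_add, map_smul, ← complexBetti.map_comp_apply' _ ((-(φ t)).hom.hom.hom ⊗ₘ Φ),
      hcommute, complexBetti.map_comp_apply' (ΨK[A, φ, t, t]).hom.hom.hom, hP, map_add, map_prodLift_map_fst,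
      map_prodLift_map_snd, map_neg_two, hKcdef]
    simp only [map_add, map_smul, smul_add]
    abel
  -- the member embedding of the product pencil at `t` carries this class: §F3 applies
  obtain ⟨es, aS, haS, haS0, hes⟩ := exists_memberEmbedding E' (hg E'.n) (hg0 E'.n (le_trans hEn hEn')) _ (e' t) hΦt het dK
  rw [hmem] at hes
  have hδ := hasWeilDiscriminantNondeg_twistedSquare_weight_one hq hdimt hdK (hφ t) et (hg E.n) (hg0 E.n hEn) es haS haS0 hes
  have hδt : HasWeilDiscriminantNondeg ((A t).prod (A t)) ΨK[A, φ, t, t] (q + 1) dK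
      (complexBetti.map (e' t).hom 2 (complexBetti.map (fiberι (snd (A t).X 𝒳 ≫ f) t) 2
        ((dK : ℂ) • complexBetti.map E'.ι 2 (g E'.n) + complexBetti.map ((-(φ t)).hom.hom.hom ⊗ₘ Φ) 2 (complexBetti.map E'.ι 2 (g E'.n)))))
      (QuotientGroup.mk ((-1 : ℚˣ) ^ (q + 1))) := by
    rw [hmem]; exact hδ
  obtain ⟨hW, hδs, hh⟩ := isHyperbolicWeilType_member_of_member hf' _ hΦ' (fun s ↦ (A s).prod (A t)) e'
    (fun s ↦ ΨK[A, φ, s, t]) hφ' hK' E' (hg E'.n) (hg0 E'.n (le_trans hEn hEn')) Up hUpt' hUp0' hWt hδt s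
  refine ⟨hW, by rw [hclass] at hδs; exact hδs, by rw [hclass] at hh; exact hh, ?_⟩
  obtain ⟨Φs', hΦs', hes'⟩ := hK' s
  obtain ⟨eS, aS', haS', haS0', heS⟩ := exists_memberEmbedding E' (hg E'.n) (hg0 E'.n (le_trans hEn hEn')) _ (e' s) hΦs' hes' dK
  exact ⟨eS, aS', haS', haS0', by rw [heS]; exact hh⟩

/-! ## §F6  g2's residual `TwistedProductWeilDataAt` from pencil-level `K`-data (four of its seven conjuncts discharged) -/

/-- **`TwistedProductWeilDataAt` FROM PENCIL-LEVEL `K`-DATA (g3).** For a threefold pencil with a `K = ℚ(√−d_K)`-action (global `Φ` over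
`S`, charts `(A_s, e_s, φ_s)`, `φ_s² = −d_K`), a projective embedding `E` of `𝒳`, an algebraic-side class `U₊` on `A_t × 𝒳` restricting to
`E₊ ∖ 0` of the twisted square at `t`, and a topological half inverse `W₀` at `t` in degree `3` with member restrictions in the Weil planes of
the twisted products `Ψ_s = φ_s × (−φ_t)`: the residual holds — its conjuncts `Ψ_s² = −d_K`, `dim = 6`, balanced type `(3,3)` and
HYPERBOLICITY are THEOREMS (§F5); `U₊` and `W₀` remain displayed. [cite: vanGeemen1994HodgeAV, 4.9, 4.11–4.14, 5.2–5.3 and 6.12]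
[cite: Deligne1982HodgeCycles, proof of Thm. 4.8] [cite: Hartshorne1977, II Ex. 5.11 and Ex. 5.12] -/
theorem twistedProductWeilDataAt_of_kAction {dK : ℕ} (hdK : 0 < dK) (hf : IsCompactAbelianPencil f (2 + 1))
    (Φ : 𝒳 ⟶ 𝒳) (hΦ : Φ ≫ f = f)
    (A : ComplexPoints S → AbelianVariety ℂ) (e : ∀ s, (A s).X ≅ fiberOver f s) (φ : ∀ s, A s ⟶ A s)
    (hφ : ∀ s, φ s ≫ φ s = -(dK • 𝟙 (A s)))
    (hK : ∀ s, ∃ Φs : fiberOver f s ⟶ fiberOver f s, Φs ≫ fiberι f s = fiberι f s ≫ Φ ∧ (e s).hom ≫ Φs = (φ s).hom.hom.hom ≫ (e s).hom)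
    (t : ComplexPoints S) (Up : complexBetti ((A t).X ⊗ 𝒳) (2 * (2 + 1)))
    (hUpt : complexBetti.map ((prodSwap (A t) (A t)).hom ≫ (A t).X ◁ ((e t).hom ≫ fiberι f t)) (2 * (2 + 1)) Up ∈
      weilClassesPlus ((A t).prod (A t)) ΨK[A, φ, t, t] (2 + 1) dK)
    (hUp0 : complexBetti.map ((A t).X ◁ fiberι f t) (2 * (2 + 1)) Up ≠ 0)
    (W₀ : complexBetti (𝒳 ⊗ fiberOver f t) (2 * (2 + 1)))
    (ha : ∀ W, complexBetti.map (fiberι f t) 3 (corrAction complexOrientationFamily (IsCompactAbelianPencil.isSmoothProjective_total hf)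
        (IsCompactAbelianPencil.isSmoothProjective_fiberOver hf t) (rfl : 3 + 2 * (2 + 1) = 3 + 2 * (2 + 1)) W₀
        (complexBetti.map (fiberι f t) 3 W)) = complexBetti.map (fiberι f t) 3 W)
    (hb : ∀ x, complexGysin complexOrientationFamily (IsCompactAbelianPencil.isSmoothProjective_fiberOver hf t)
        (IsCompactAbelianPencil.isSmoothProjective_total hf) (fiberι f t) (deg_fiberGysin_aux 3 (2 + 1)) x = 0 →
      complexBetti.map (fiberι f t) 3 (corrAction complexOrientationFamily (IsCompactAbelianPencil.isSmoothProjective_total hf)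
        (IsCompactAbelianPencil.isSmoothProjective_fiberOver hf t) (rfl : 3 + 2 * (2 + 1) = 3 + 2 * (2 + 1)) W₀ x) = 0)
    (hW : ∀ s, complexBetti.map (tensorIso (e s) (e t)).hom (2 * (2 + 1))
        (complexBetti.map (fiberι f s ▷ fiberOver f t) (2 * (2 + 1)) W₀) ∈ weilClassesOf ((A s).prod (A t)) ΨK[A, φ, s, t] (2 + 1) dK) :
    TwistedProductWeilDataAt hf t dK := by
  -- a Segre-additive family of rational hyperplane classes, and a projective embedding of `𝒳` into `ℙⁿ` with `n ≥ 1`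
  obtain ⟨g, hg, hg0, hgσ⟩ := exists_segreHyperplaneClasses
  obtain ⟨n, ιX, hιX⟩ := (IsCompactAbelianPencil.isSmoothProjective_total hf).isProjectiveOver
  haveI := hιX
  let E : ProjectiveEmbedding 𝒳 := ⟨n + 1, ιX ≫ ProjectiveSpace.skipMap (k := ℂ) (0 : Fin (n + 2)), by
    change IsClosedImmersion (ιX.left ≫ (ProjectiveSpace.skipMap (k := ℂ) (0 : Fin (n + 2))).left)
    infer_instance⟩
  obtain ⟨E', -, -, hall⟩ := twistedProduct_members_weilType_hyperbolic hdK (by norm_num) hf Φ hΦ A e φ hφ hK t g hg hg0 hgσ E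
    (show 1 ≤ n + 1 by omega) Up hUpt hUp0
  have hdim : ∀ s, ((A s).prod (A t)).dim = 2 * 3 := fun s ↦ (hall s).1.dim_eq
  refine ⟨A, e, fun s ↦ ΨK[A, φ, s, t], hdim, W₀, hdK, fun s ↦ (hall s).1.sq_eq, fun s ↦ (hall s).1.multiplicity_eq,
    fun s ↦ ?_, ha, hb, hW⟩
  obtain ⟨-, -, -, es, aS, haS, haS0, hh⟩ := hall s
  exact ⟨es, aS, haS, haS0, hh⟩

end Summit.HodgeConjecture.HodgeConjecture.Ring2.AbelianAll.OddCell

end
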